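import Summits.QuantumFields.BalabanUV.Beta.FP.StepRecursionFeedNestedCompUpTo

/-!
# `BalabanUV.Beta.FP.StepRecursionFeedNestedCompFed` — road «FP» for binder row D1: **THE ROAD's END AT THE RECORD PAIR WITH THE DOOR FED
# CONSISTENTLY** — the TRANSPORT clause carrying the FED one-shot kernel `hessKer N_j^rec − D j` inside the dressing (an2 g74 J-NOTE-18 §2 (b),
# W-4 l.68478 (3)), plus the `htr`-COVARIANCE row of the defect `hDΔtr`; then an4's remainder is the BASE defect `D 1` alone and the END asks the
# four remainder binders OF `D 1` ONLY (`HessianTelescopingKKT.d1Tel_of_stepRecursionUpTo_wStep` with `R 1 = D 1`, `R (j+2) = 0`)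

WHY.  `StepRecursionFeedNestedCompUpTo` §2 keeps v9's transport clause VERBATIM — the record's door-free `hessKer (AN j) (VN j) (WN j)` inside the dressing —
so its displayed defect `D j` is the FULL door residue of storey `j` and the binder asks `hD0 hD1 hDA hD2` of EVERY `D j` (G2 ∕ G2-M2 at each depth are the
witnesses).  If instead the door family is fed CONSISTENTLY (the storey-`(j+1)` fine system IS the storey-`j` FED one-shot system transported: `htr′` below, the
fed kernel being `hessKer N_j^rec − D j` = `hessKer (AN j) (VN j) (WN j + 𝒲Δ j)` for `D := −½·tadpole (AN j) (𝒲Δ∞ j · 0 · ·)` by `WSlotSplit.hessKer_add_W` —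
letters of the v10-class wrapper, NOT typed here), then by LINEARITY of the dressing (`dressedEntry_sub`, absolutely summable entries) an4's step remainder at
storey `j + 1 ≥ 2` is `D (j+1) − Lc⁸·dressedEntry (wStep Lc (j+1)) (D j) (Lc•·)` and at the base it is `D 1` (`hF₁` pins `F_1` door-free — J-NOTE-18 §2 (a)).
Under the DISPLAYED covariance row `hDΔtr : D (j+1) μ ν z = Lc⁸·dressedEntry (wStep Lc (j+1)) (D j) (Lc•z) μ ν` (J-NOTE-18 §2 (b), G3's shape) the steps'
remainders VANISH IDENTICALLY, and `D1Tel` follows from an4's four binders AT THE BASE ONLY: `hD0₁ hD1₁ hD2₁` on `D 1` (+ `hDA` at every storey, for the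
dressing's linearity).  So: G2 ∕ G2-M2 at n = 0 read the base; G3 reads `hDΔtr`; nothing else is asked of the door.

WHAT.  Blocking `Lc` (`[NeZero Lc]`, `Odd Lc`), dimension four, ROOT M‴'s `Js := JsB12CombShSym hLc N (symTablesAn1S2 3 Lc cΛ) cΛ cB` UNCHANGED.
* §1 [folklore] `dressedEntry_sub` — the two-sided dressed entry is additive in the middle kernel (absolutely summable second moments of the pattern's and
  of both kernels' entries; `DecimatedMomentSummable.summable_dressed_fibre` + `tsum_sub`).
* §2 [folklore] **KERNEL-ENTRY LEVEL, ANY `Jc` ANCHORED AT `m = 1`**: `d1Tel_anchored_of_kernel_laws_fed_wStep` — door `𝒦N j = 𝒦F j + 𝒦G j + D j` (`j ≥ 1`),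
  `hN`, `hF₁`, the FED transport `htr′ : 𝒦F (j+1) a b z = Lc⁸·dressedEntry (wStep Lc (j+1)) (𝒦N j − D j) (Lc•z) a b`, `hG`, (T0)(T1), `hDA` (`j ≥ 1`), `hDΔtr`,
  and AT THE BASE `hD0₁ hD1₁ hD2₁` ⟹ `D1Tel Lc Js Jc` (an4 §8 with `R j := D 1` at `j = 1`, `0` above).
* §3 [folklore] **NESTED CURRENCY AT THE RECORD PAIR, (β1) INSTANCE**: `d1Tel_JcComp_ctr_nested_of_hessKer_laws_fed_wStep` — #31's rows with `hlaw` carrying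
  `+ D j μ ν z`, `hF₁ hG hT0 hT1` VERBATIM, the FED transport `htr′` (inner kernel `fun c e t => hessKer (AN j)(VN j)(WN j) c e t − D j c e t`), `hN := hN_JcComp`,
  `hDA`, `hDΔtr`, and the base binders ⟹ `D1Tel Lc Js (JcComp hLc N cΛ cB (Roots.ctr Lc) P)`.
* §4 [folklore] **THE READ-OUT-LEVEL TWINS** (RULING (R27)∕(R28-1), channel `(μ, ν)`): `stepRecursionUpTo_base_of_fed` (the fed rows ⟹ an4's
  `StepRecursionUpTo` with the remainder `D 1` at the base and `0` above — the recursion §2 builds inline, as a lemma), `d1Sum_anchored_of_kernel_laws_fed_wStep` and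
  `d1Sum_JcComp_ctr_nested_of_hessKer_laws_fed_wStep` — the same rows with the base binder `hDF₁ : secondMoment (D 1) μ ν = 0` in place of `hD2₁` ⟹ the lead's
  `StepDriftWitness.D1Sum … μ ν` (an4 §9 `secondMomentSum_of_stepRecursionUpTo_wStep` through `d1Sum_iff`).
[folklore] composition BY NAME + one linearity lemma; no `def`, no `def … : Prop`, nothing cited, 0 sorry.  Every displayed row is a HYPOTHESIS; nothing of the
dictionary ∕ Bałaban's asserted, valued or discharged; NO defect claimed to vanish, to be covariant or to be invisible (by value: G2 = Engine C K2L-DTAD measures the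
n = 0 door tadpole entrywise, zero weight; G2-M2 ∕ G3 unmeasured); the target `D1Tel` UNCHANGED ((ii-D) NOT typed).  No existing file touched.

HONEST DEPENDENCY (page 1, mandatory): continuum YM on T⁴ ⇐ BetaPertH ∧ nine spine estimates (0/9 proved); BetaPertH ⇐ (D1) ∧ (D4) ∧ CAP+tail;
G-an2-4 gates asym, D1 and NE2/3/4.  HONEST FRAMING (cell contract, verbatim): «discharging `BetaPertH` makes Bałaban's UV stability UNCONDITIONAL —
a real constructive-QFT result; it is NOT the continuum limit and NOT the Clay problem.»  ABSOLUTE RULE (cell charter, verbatim): «No internally-minted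
statement may enter as a cited fact. Every hypothesis is either kernel-proved in this package or a verbatim quotation of a PUBLISHED theorem with page
reference. The manuscript(s) under audit are NOT citable for their own disputed steps — they are the thing under adjudication; programme-internal
(2001/route/tribunal) claims are never citable.»  0 estimates; 0∕4 row-D1 binders (hW, hR, D1Tel, D1Rep); ROOT M‴ p325680 untouched; NOT (C1), NOT (L2′)
beyond `hN`'s name, NOT (T-ID), NOT SDF, NOT D1, NEVER «G-an2-4 closed», NOT BetaPertH, NOT continuum, NOT Clay.  Road «FP» OWNER, b2b-balaban-beta-d1-p3
gen 51, 2026-08-28.  No existing file touched.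
-/

noncomputable section

namespace Summit.QuantumFields.BalabanUV.Beta.FP.StepRecursionFeedNestedCompFed

open Finset
open Literature.MathematicalPhysics.QuantumFieldTheory
open Literature.MathematicalPhysics.QuantumFieldTheory.Balaban1983to89
open Literature.MathematicalPhysics.QuantumFieldTheory.Balaban1983to89.Beta
open DecimatedMomentSummable (AbsMoment₂ dressedSum summable_dressed_fibre)
open DressedMomentNormalisation (EKer dressedEntry m2Tensor)
open ExpKernelCalculus (MKer hessKer)
open OneStepResolventKernel (Fib JetData)
open OneStepKernelFamily (TshotOf TbalOf D1Tel absMoment₂_TshotOf)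
open HessianTelescopingKKT (StepRecursionUpTo wStep absMoment₂_wStep d1Tel_of_stepRecursionUpTo_wStep secondMomentSum_of_stepRecursionUpTo_wStep)
open Literature.MathematicalPhysics.QuantumFieldTheory.Balaban1983to89.B12Beta (secondMoment)
open StepDriftWitness (D1Sum)
open Summit.QuantumFields.BalabanUV.Beta.SymSecondOrderTablesAn1 (symTablesAn1S2)
open Summit.QuantumFields.BalabanUV.Beta.CombChartJointEnd (JsB12CombShSym)
open Summit.QuantumFields.BalabanUV.Beta.CombOneShotJets (JcOf TshotOf_JcOf_one)
open Summit.QuantumFields.BalabanUV.Beta.CompositeOneShotJetData (Roots Pins JcComp JcComp_one AN VN WN hN_JcComp)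

/-! ## §1 Linearity of the two-sided dressed entry in the middle kernel -/

section Linear

/-- [folklore] **THE DRESSED ENTRY IS ADDITIVE IN THE MIDDLE KERNEL** (absolutely summable second moments of every entry of the pattern `w` and of both kernels):
`dressedEntry w (T − T′) y a b = dressedEntry w T y a b − dressedEntry w T′ y a b`. -/
theorem dressedEntry_sub (w T T' : EKer 4) (hw : ∀ κ l : Fin 4, AbsMoment₂ (w κ l)) (hT : ∀ c e : Fin 4, AbsMoment₂ (T c e))
    (hT' : ∀ c e : Fin 4, AbsMoment₂ (T' c e)) (y : Fin 4 → ℤ) (a b : Fin 4) :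
    dressedEntry w (fun c e z => T c e z - T' c e z) y a b = dressedEntry w T y a b - dressedEntry w T' y a b := by
  unfold dressedEntry
  rw [← Finset.sum_sub_distrib]
  refine Finset.sum_congr rfl fun c _ => ?_
  rw [← Finset.sum_sub_distrib]
  refine Finset.sum_congr rfl fun e _ => ?_
  unfold dressedSum
  rw [← (summable_dressed_fibre (hw c a) (hT c e) (hw e b) y).tsum_sub (summable_dressed_fibre (hw c a) (hT' c e) (hw e b) y)]
  refine tsum_congr fun p => ?_
  ring

end Linear

/-! ## §2 Kernel-entry level: any `Jc` anchored at `m = 1`, the door WITH a defect, the FED transport, the covariance row, binders at the base -/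

section Anchored

variable {Lc : ℕ} [NeZero Lc]

/-- [folklore] **`D1Tel` AT M‴'s LITERAL FOR ANY COMPOSITE FAMILY ANCHORED AT `m = 1`, DOOR FED CONSISTENTLY, DEFECT `htr`-COVARIANT.**  The
de-periodised door per `j ≥ 1` WITH a displayed defect `D j` (`hlaw`), the one-shot identification `hN`, the anchor storey's fine identification `hF₁`
(door-free), the FED transport clause `htr′` (the storey-`(j+1)` fine kernel is the dressing of the FED storey-`j` one-shot kernel `𝒦N j − D j`), the
top-step identification `hG`, (T0)(T1), absolutely summable second moments of every `D j` (`hDA`, for the dressing's linearity), the COVARIANCE ROW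
`hDtr : D (j+1) a b z = Lc⁸·dressedEntry (wStep Lc (j+1)) (D j) (Lc•z) a b` (`j ≥ 1`), and an4's binders AT THE BASE ONLY (`hD0₁ hD1₁ hD2₁` on `D 1`)
⟹ `D1Tel Lc (JsB12CombShSym …) Jc` — an4 §8 `d1Tel_of_stepRecursionUpTo_wStep` with the remainder `D 1` at `j = 1` and `0` at `j ≥ 2`. -/
theorem d1Tel_anchored_of_kernel_laws_fed_wStep (hLc : Odd Lc) (N : ℕ) (cΛ cB : ℝ) (Jc : ∀ m : ℕ, JetData 3 (Lc ^ m))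
    (hJc1 : Jc 1 = JcOf hLc N (fun _ => cΛ) (fun _ => cB) 1) (𝒦N 𝒦F 𝒦G D : ℕ → EKer 4)
    (hlaw : ∀ j : ℕ, 1 ≤ j → ∀ (a b : Fin 4) (z : Fin 4 → ℤ), 𝒦N j a b z = 𝒦F j a b z + 𝒦G j a b z + D j a b z)
    (hN : ∀ j : ℕ, 1 ≤ j → ∀ (a b : Fin 4) (z : Fin 4 → ℤ), 𝒦N j a b z = TshotOf Lc Jc (j + 1) a b z)
    (hF₁ : ∀ (a b : Fin 4) (z : Fin 4 → ℤ), 𝒦F 1 a b z = (Lc : ℝ) ^ 8 * dressedEntry (wStep Lc 1) (TshotOf Lc Jc 1) ((Lc : ℤ) • z) a b)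
    (htr' : ∀ j : ℕ, 1 ≤ j → ∀ (a b : Fin 4) (z : Fin 4 → ℤ),
      𝒦F (j + 1) a b z = (Lc : ℝ) ^ 8 * dressedEntry (wStep Lc (j + 1)) (fun c e t => 𝒦N j c e t - D j c e t) ((Lc : ℤ) • z) a b)
    (hG : ∀ j : ℕ, 1 ≤ j → ∀ (a b : Fin 4) (z : Fin 4 → ℤ),
      𝒦G j a b z = TbalOf Lc (JsB12CombShSym hLc N (symTablesAn1S2 3 Lc cΛ) cΛ cB) j a b z)
    (hT0 : ∀ j (c e : Fin 4), HasSum (TbalOf Lc (JsB12CombShSym hLc N (symTablesAn1S2 3 Lc cΛ) cΛ cB) j c e) 0)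
    (hT1 : ∀ j (c e ρ : Fin 4), HasSum (fun t : Fin 4 → ℤ => t ρ • TbalOf Lc (JsB12CombShSym hLc N (symTablesAn1S2 3 Lc cΛ) cΛ cB) j c e t) 0)
    (hDA : ∀ j, 1 ≤ j → ∀ c e : Fin 4, AbsMoment₂ (D j c e))
    (hDtr : ∀ j : ℕ, 1 ≤ j → ∀ (a b : Fin 4) (z : Fin 4 → ℤ),
      D (j + 1) a b z = (Lc : ℝ) ^ 8 * dressedEntry (wStep Lc (j + 1)) (D j) ((Lc : ℤ) • z) a b)
    (hD0₁ : ∀ c e : Fin 4, HasSum (D 1 c e) 0)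
    (hD1₁ : ∀ c e ρ : Fin 4, HasSum (fun t : Fin 4 → ℤ => t ρ • D 1 c e t) 0) (hD2₁ : m2Tensor (D 1) = 0) :
    D1Tel Lc (JsB12CombShSym hLc N (symTablesAn1S2 3 Lc cΛ) cΛ cB) Jc := by
  have hbase : TshotOf Lc Jc 1 = TbalOf Lc (JsB12CombShSym hLc N (symTablesAn1S2 3 Lc cΛ) cΛ cB) 0 := by
    have h1 : TshotOf Lc Jc 1 = TshotOf Lc (JcOf hLc N (fun _ => cΛ) (fun _ => cB)) 1 := by
      show OneStepResolventKernel.TOf (N := Lc ^ 1) (Jc 1) = OneStepResolventKernel.TOf (N := Lc ^ 1) (JcOf hLc N (fun _ => cΛ) (fun _ => cB) 1)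
      rw [hJc1]
    exact h1.trans (TshotOf_JcOf_one hLc N (fun _ => cΛ) (fun _ => cB))
  -- the one-shot identification as an equality of kernels
  have hNf : ∀ j : ℕ, 1 ≤ j → 𝒦N j = TshotOf Lc Jc (j + 1) :=
    fun j hj => funext fun a => funext fun b => funext fun z => hN j hj a b z
  -- an4's remainder: the base defect at `j = 1`, nothing above
  let R : ℕ → EKer 4 := fun j c e z => if j = 1 then D 1 c e z else 0
  have hR1 : R 1 = D 1 := by
    funext c e z
    exact if_pos rfl
  have hRne : ∀ j : ℕ, j ≠ 1 → R j = 0 := by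
    intro j hj
    funext c e z
    exact if_neg hj
  have hrec : StepRecursionUpTo Lc (TbalOf Lc (JsB12CombShSym hLc N (symTablesAn1S2 3 Lc cΛ) cΛ cB)) (TshotOf Lc Jc) (wStep Lc) R := by
    intro j hj a b z
    obtain ⟨k, rfl⟩ : ∃ k : ℕ, j = k + 1 := ⟨j - 1, (Nat.sub_add_cancel hj).symm⟩
    cases k with
    | zero =>
      rw [← hN 1 hj a b z, hlaw 1 hj a b z, hF₁ a b z, hG 1 hj a b z, hR1]
    | succ k =>
      have hk : 1 ≤ k + 1 := Nat.succ_pos k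
      have hsub : dressedEntry (wStep Lc (k + 1 + 1)) (fun c e t => 𝒦N (k + 1) c e t - D (k + 1) c e t) ((Lc : ℤ) • z) a b
          = dressedEntry (wStep Lc (k + 1 + 1)) (TshotOf Lc Jc (k + 1 + 1)) ((Lc : ℤ) • z) a b
            - dressedEntry (wStep Lc (k + 1 + 1)) (D (k + 1)) ((Lc : ℤ) • z) a b := by
        rw [← dressedEntry_sub (wStep Lc (k + 1 + 1)) (TshotOf Lc Jc (k + 1 + 1)) (D (k + 1)) (absMoment₂_wStep (k + 1 + 1))
          (absMoment₂_TshotOf Jc (k + 1 + 1)) (hDA (k + 1) hk), hNf (k + 1) hk]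
      rw [← hN (k + 1 + 1) hj a b z, hlaw (k + 1 + 1) hj a b z, htr' (k + 1) hk a b z, hsub, hG (k + 1 + 1) hj a b z,
        hDtr (k + 1) hk a b z, hRne (k + 1 + 1) (by omega)]
      simp only [Pi.zero_apply]
      ring
  refine d1Tel_of_stepRecursionUpTo_wStep _ Jc (R := R) hT0 hT1 ?_ ?_ ?_ ?_ hbase hrec
  · intro j hj c e
    by_cases h : j = 1
    · subst h; rw [hR1]; exact hD0₁ c e
    · rw [hRne j h]; exact hasSum_zero
  · intro j hj c e ρ
    by_cases h : j = 1
    · subst h; rw [hR1]; exact hD1₁ c e ρ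
    · rw [hRne j h]; simp only [Pi.zero_apply, smul_zero]; exact hasSum_zero
  · intro j hj c e
    by_cases h : j = 1
    · subst h; rw [hR1]; exact hDA 1 hj c e
    · rw [hRne j h]; exact StepDriftWitness.absMoment₂_zero_gen
  · intro j hj
    by_cases h : j = 1
    · subst h; rw [hR1]; exact hD2₁
    · rw [hRne j h]
      funext κ lam a b
      simp only [m2Tensor, Pi.zero_apply, smul_zero, tsum_zero]

end Anchored

/-! ## §3 Nested currency at the record pair, (β1) instance: the FED transport in `hessKer` letters -/

section Nested

variable {Lc : ℕ} [NeZero Lc] {FF FG : Type*} [Fintype FF] [Fintype FG]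

/-- [folklore] **ROOT M‴'s `htel` AT THE RECORD PAIR, NESTED CURRENCY, DOOR FED CONSISTENTLY, DEFECT `htr`-COVARIANT.**  #31's rows with `hlaw`
carrying `+ D j μ ν z` at an2's N-system `(AN, VN, WN) (Roots.ctr Lc)`, `hF₁ hG hT0 hT1` VERBATIM, the FED transport clause
`htr′ : hessKer F_{j+1} μ ν z = Lc⁸·dressedEntry (wStep Lc (j+1)) (fun c e t => hessKer N_j^rec c e t − D j c e t) (Lc•z) μ ν` (the fine system of storey
`j + 1` IS the door-corrected one-shot system of storey `j` transported), `hN := hN_JcComp`, `hDA` (`j ≥ 1`), the covariance row `hDΔtr`, and an4's binders on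
the BASE defect `D 1` only ⟹ `D1Tel Lc Js (JcComp hLc N cΛ cB (Roots.ctr Lc) P)`. -/
theorem d1Tel_JcComp_ctr_nested_of_hessKer_laws_fed_wStep (hLc : Odd Lc) (N : ℕ) (cΛ cB : ℝ) (P : Pins)
    (AF : ℕ → MKer 4 FF) (𝒱F : ℕ → Fin 4 → (Fin 4 → ℤ) → MKer 4 FF) (𝒲F : ℕ → Fin 4 → (Fin 4 → ℤ) → Fin 4 → (Fin 4 → ℤ) → MKer 4 FF)
    (AG : ℕ → MKer 4 FG) (𝒱G : ℕ → Fin 4 → (Fin 4 → ℤ) → MKer 4 FG) (𝒲G : ℕ → Fin 4 → (Fin 4 → ℤ) → Fin 4 → (Fin 4 → ℤ) → MKer 4 FG)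
    (D : ℕ → EKer 4)
    (hlaw : ∀ j : ℕ, 1 ≤ j → ∀ (μ ν : Fin 4) (z : Fin 4 → ℤ),
      hessKer (AN (Roots.ctr Lc) j) (VN (Roots.ctr Lc) P j) (WN (Roots.ctr Lc) P j) μ ν z
        = hessKer (AF j) (𝒱F j) (𝒲F j) μ ν z + hessKer (AG j) (𝒱G j) (𝒲G j) μ ν z + D j μ ν z)
    (hF₁ : ∀ (μ ν : Fin 4) (z : Fin 4 → ℤ),
      hessKer (AF 1) (𝒱F 1) (𝒲F 1) μ ν z
        = (Lc : ℝ) ^ 8 * dressedEntry (wStep Lc 1) (TshotOf Lc (JcComp hLc N cΛ cB (Roots.ctr Lc) P) 1) ((Lc : ℤ) • z) μ ν)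
    (htr' : ∀ j : ℕ, 1 ≤ j → ∀ (μ ν : Fin 4) (z : Fin 4 → ℤ),
      hessKer (AF (j + 1)) (𝒱F (j + 1)) (𝒲F (j + 1)) μ ν z
        = (Lc : ℝ) ^ 8 * dressedEntry (wStep Lc (j + 1))
            (fun c e t => hessKer (AN (Roots.ctr Lc) j) (VN (Roots.ctr Lc) P j) (WN (Roots.ctr Lc) P j) c e t - D j c e t) ((Lc : ℤ) • z) μ ν)
    (hG : ∀ j : ℕ, 1 ≤ j → ∀ (μ ν : Fin 4) (z : Fin 4 → ℤ),
      hessKer (AG j) (𝒱G j) (𝒲G j) μ ν z = TbalOf Lc (JsB12CombShSym hLc N (symTablesAn1S2 3 Lc cΛ) cΛ cB) j μ ν z)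
    (hT0 : ∀ j (c e : Fin 4), HasSum (TbalOf Lc (JsB12CombShSym hLc N (symTablesAn1S2 3 Lc cΛ) cΛ cB) j c e) 0)
    (hT1 : ∀ j (c e ρ : Fin 4), HasSum (fun t : Fin 4 → ℤ => t ρ • TbalOf Lc (JsB12CombShSym hLc N (symTablesAn1S2 3 Lc cΛ) cΛ cB) j c e t) 0)
    (hDA : ∀ j, 1 ≤ j → ∀ c e : Fin 4, AbsMoment₂ (D j c e))
    (hDtr : ∀ j : ℕ, 1 ≤ j → ∀ (μ ν : Fin 4) (z : Fin 4 → ℤ),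
      D (j + 1) μ ν z = (Lc : ℝ) ^ 8 * dressedEntry (wStep Lc (j + 1)) (D j) ((Lc : ℤ) • z) μ ν)
    (hD0₁ : ∀ c e : Fin 4, HasSum (D 1 c e) 0)
    (hD1₁ : ∀ c e ρ : Fin 4, HasSum (fun t : Fin 4 → ℤ => t ρ • D 1 c e t) 0) (hD2₁ : m2Tensor (D 1) = 0) :
    D1Tel Lc (JsB12CombShSym hLc N (symTablesAn1S2 3 Lc cΛ) cΛ cB) (JcComp hLc N cΛ cB (Roots.ctr Lc) P) :=
  d1Tel_anchored_of_kernel_laws_fed_wStep hLc N cΛ cB (JcComp hLc N cΛ cB (Roots.ctr Lc) P) (JcComp_one hLc N cΛ cB (Roots.ctr Lc) P)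
    (fun j => hessKer (AN (Roots.ctr Lc) j) (VN (Roots.ctr Lc) P j) (WN (Roots.ctr Lc) P j))
    (fun j => hessKer (AF j) (𝒱F j) (𝒲F j)) (fun j => hessKer (AG j) (𝒱G j) (𝒲G j)) D
    hlaw (hN_JcComp hLc N cΛ cB (Roots.ctr Lc) P) hF₁ htr' hG hT0 hT1 hDA hDtr hD0₁ hD1₁ hD2₁

end Nested

/-! ## §4 The read-out-level twins: the fed recursion as a lemma, and `D1Sum` from the base binder `hDF₁` -/

section Readout

variable {Lc : ℕ} [NeZero Lc]

/-- [folklore] **THE FED ROWS GIVE an4's RECURSION MODULO THE BASE DEFECT ALONE**: door with defect `D j`, `hN`, `hF₁` door-free, the FED transport `htr′`, `hG`,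
`hDA` (`j ≥ 1`) and the covariance row `hDtr` ⟹ `StepRecursionUpTo Lc (TbalOf Lc Js) (TshotOf Lc Jc) (wStep Lc) R` with `R j := D 1` at `j = 1` and `0` at `j ≠ 1`
(§2's inline construction, as a lemma: at the base `hF₁` leaves `D 1`; above, `dressedEntry_sub` splits the fed transport and `hDtr` cancels the dressed `D j` against `D (j+1)`). -/
theorem stepRecursionUpTo_base_of_fed (Js : ℕ → JetData 3 Lc) (Jc : ∀ m : ℕ, JetData 3 (Lc ^ m)) (𝒦N 𝒦F 𝒦G D : ℕ → EKer 4)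
    (hlaw : ∀ j : ℕ, 1 ≤ j → ∀ (a b : Fin 4) (z : Fin 4 → ℤ), 𝒦N j a b z = 𝒦F j a b z + 𝒦G j a b z + D j a b z)
    (hN : ∀ j : ℕ, 1 ≤ j → ∀ (a b : Fin 4) (z : Fin 4 → ℤ), 𝒦N j a b z = TshotOf Lc Jc (j + 1) a b z)
    (hF₁ : ∀ (a b : Fin 4) (z : Fin 4 → ℤ), 𝒦F 1 a b z = (Lc : ℝ) ^ 8 * dressedEntry (wStep Lc 1) (TshotOf Lc Jc 1) ((Lc : ℤ) • z) a b)
    (htr' : ∀ j : ℕ, 1 ≤ j → ∀ (a b : Fin 4) (z : Fin 4 → ℤ),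
      𝒦F (j + 1) a b z = (Lc : ℝ) ^ 8 * dressedEntry (wStep Lc (j + 1)) (fun c e t => 𝒦N j c e t - D j c e t) ((Lc : ℤ) • z) a b)
    (hG : ∀ j : ℕ, 1 ≤ j → ∀ (a b : Fin 4) (z : Fin 4 → ℤ), 𝒦G j a b z = TbalOf Lc Js j a b z)
    (hDA : ∀ j, 1 ≤ j → ∀ c e : Fin 4, AbsMoment₂ (D j c e))
    (hDtr : ∀ j : ℕ, 1 ≤ j → ∀ (a b : Fin 4) (z : Fin 4 → ℤ),
      D (j + 1) a b z = (Lc : ℝ) ^ 8 * dressedEntry (wStep Lc (j + 1)) (D j) ((Lc : ℤ) • z) a b) :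
    StepRecursionUpTo Lc (TbalOf Lc Js) (TshotOf Lc Jc) (wStep Lc) (fun j c e z => if j = 1 then D 1 c e z else 0) := by
  have hNf : ∀ j : ℕ, 1 ≤ j → 𝒦N j = TshotOf Lc Jc (j + 1) :=
    fun j hj => funext fun a => funext fun b => funext fun z => hN j hj a b z
  intro j hj a b z
  obtain ⟨k, rfl⟩ : ∃ k : ℕ, j = k + 1 := ⟨j - 1, (Nat.sub_add_cancel hj).symm⟩
  cases k with
  | zero =>
    rw [← hN 1 hj a b z, hlaw 1 hj a b z, hF₁ a b z, hG 1 hj a b z]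
    simp only [if_true]
  | succ k =>
    have hk : 1 ≤ k + 1 := Nat.succ_pos k
    have hsub : dressedEntry (wStep Lc (k + 1 + 1)) (fun c e t => 𝒦N (k + 1) c e t - D (k + 1) c e t) ((Lc : ℤ) • z) a b
        = dressedEntry (wStep Lc (k + 1 + 1)) (TshotOf Lc Jc (k + 1 + 1)) ((Lc : ℤ) • z) a b
          - dressedEntry (wStep Lc (k + 1 + 1)) (D (k + 1)) ((Lc : ℤ) • z) a b := by
      rw [← dressedEntry_sub (wStep Lc (k + 1 + 1)) (TshotOf Lc Jc (k + 1 + 1)) (D (k + 1)) (absMoment₂_wStep (k + 1 + 1))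
        (absMoment₂_TshotOf Jc (k + 1 + 1)) (hDA (k + 1) hk), hNf (k + 1) hk]
    have hne : (k + 1 + 1 = 1) = False := by
      apply propext; constructor
      · intro h; omega
      · intro h; exact False.elim h
    rw [← hN (k + 1 + 1) hj a b z, hlaw (k + 1 + 1) hj a b z, htr' (k + 1) hk a b z, hsub, hG (k + 1 + 1) hj a b z,
      hDtr (k + 1) hk a b z]
    simp only [hne, if_false]
    ring

/-- [folklore] **`D1Sum` FOR ANY COMPOSITE FAMILY ANCHORED AT `m = 1`, DOOR FED CONSISTENTLY, DEFECT `htr`-COVARIANT** (channel `(μ, ν)`): §2's rows with the base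
binder `hDF₁ : secondMoment (D 1) μ ν = 0` in place of `hD2₁` ⟹ the lead's `D1Sum Lc (JsB12CombShSym …) Jc μ ν` (an4 §9 with the remainder of
`stepRecursionUpTo_base_of_fed`). -/
theorem d1Sum_anchored_of_kernel_laws_fed_wStep (hLc : Odd Lc) (N : ℕ) (cΛ cB : ℝ) (Jc : ∀ m : ℕ, JetData 3 (Lc ^ m))
    (hJc1 : Jc 1 = JcOf hLc N (fun _ => cΛ) (fun _ => cB) 1) (𝒦N 𝒦F 𝒦G D : ℕ → EKer 4) (μ ν : Fin 4)
    (hlaw : ∀ j : ℕ, 1 ≤ j → ∀ (a b : Fin 4) (z : Fin 4 → ℤ), 𝒦N j a b z = 𝒦F j a b z + 𝒦G j a b z + D j a b z)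
    (hN : ∀ j : ℕ, 1 ≤ j → ∀ (a b : Fin 4) (z : Fin 4 → ℤ), 𝒦N j a b z = TshotOf Lc Jc (j + 1) a b z)
    (hF₁ : ∀ (a b : Fin 4) (z : Fin 4 → ℤ), 𝒦F 1 a b z = (Lc : ℝ) ^ 8 * dressedEntry (wStep Lc 1) (TshotOf Lc Jc 1) ((Lc : ℤ) • z) a b)
    (htr' : ∀ j : ℕ, 1 ≤ j → ∀ (a b : Fin 4) (z : Fin 4 → ℤ),
      𝒦F (j + 1) a b z = (Lc : ℝ) ^ 8 * dressedEntry (wStep Lc (j + 1)) (fun c e t => 𝒦N j c e t - D j c e t) ((Lc : ℤ) • z) a b)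
    (hG : ∀ j : ℕ, 1 ≤ j → ∀ (a b : Fin 4) (z : Fin 4 → ℤ),
      𝒦G j a b z = TbalOf Lc (JsB12CombShSym hLc N (symTablesAn1S2 3 Lc cΛ) cΛ cB) j a b z)
    (hT0 : ∀ j (c e : Fin 4), HasSum (TbalOf Lc (JsB12CombShSym hLc N (symTablesAn1S2 3 Lc cΛ) cΛ cB) j c e) 0)
    (hT1 : ∀ j (c e ρ : Fin 4), HasSum (fun t : Fin 4 → ℤ => t ρ • TbalOf Lc (JsB12CombShSym hLc N (symTablesAn1S2 3 Lc cΛ) cΛ cB) j c e t) 0)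
    (hDA : ∀ j, 1 ≤ j → ∀ c e : Fin 4, AbsMoment₂ (D j c e))
    (hDtr : ∀ j : ℕ, 1 ≤ j → ∀ (a b : Fin 4) (z : Fin 4 → ℤ),
      D (j + 1) a b z = (Lc : ℝ) ^ 8 * dressedEntry (wStep Lc (j + 1)) (D j) ((Lc : ℤ) • z) a b)
    (hD0₁ : ∀ c e : Fin 4, HasSum (D 1 c e) 0)
    (hD1₁ : ∀ c e ρ : Fin 4, HasSum (fun t : Fin 4 → ℤ => t ρ • D 1 c e t) 0) (hDF₁ : secondMoment (D 1) μ ν = 0) :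
    D1Sum Lc (JsB12CombShSym hLc N (symTablesAn1S2 3 Lc cΛ) cΛ cB) Jc μ ν := by
  have hbase : TshotOf Lc Jc 1 = TbalOf Lc (JsB12CombShSym hLc N (symTablesAn1S2 3 Lc cΛ) cΛ cB) 0 := by
    have h1 : TshotOf Lc Jc 1 = TshotOf Lc (JcOf hLc N (fun _ => cΛ) (fun _ => cB)) 1 := by
      show OneStepResolventKernel.TOf (N := Lc ^ 1) (Jc 1) = OneStepResolventKernel.TOf (N := Lc ^ 1) (JcOf hLc N (fun _ => cΛ) (fun _ => cB) 1)
      rw [hJc1]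
    exact h1.trans (TshotOf_JcOf_one hLc N (fun _ => cΛ) (fun _ => cB))
  have hrec := stepRecursionUpTo_base_of_fed (JsB12CombShSym hLc N (symTablesAn1S2 3 Lc cΛ) cΛ cB) Jc 𝒦N 𝒦F 𝒦G D hlaw hN hF₁ htr' hG hDA hDtr
  rw [StepDriftWitness.d1Sum_iff]
  refine secondMomentSum_of_stepRecursionUpTo_wStep _ Jc μ ν hT0 hT1 ?_ ?_ ?_ ?_ hbase hrec
  · intro j hj c e
    by_cases h : j = 1
    · subst h; simp only [if_true]; exact hD0₁ c e
    · simp only [h, if_false]; exact hasSum_zero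
  · intro j hj c e ρ
    by_cases h : j = 1
    · subst h; simp only [if_true]; exact hD1₁ c e ρ
    · simp only [h, if_false, smul_zero]; exact hasSum_zero
  · intro j hj c e
    by_cases h : j = 1
    · subst h; simp only [if_true]; exact hDA 1 hj c e
    · simp only [h, if_false]; exact StepDriftWitness.absMoment₂_zero_gen
  · intro j hj
    by_cases h : j = 1
    · subst h; simp only [if_true]; exact hDF₁
    · simp only [secondMoment, h, if_false, zero_mul, tsum_zero]

end Readout

section ReadoutNested

variable {Lc : ℕ} [NeZero Lc] {FF FG : Type*} [Fintype FF] [Fintype FG]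

/-- [folklore] **THE READ-OUT-LEVEL END AT THE RECORD PAIR, DOOR FED CONSISTENTLY, (β1) INSTANCE** (channel `(μ, ν)`): §3's rows with the base binder
`hDF₁ : secondMoment (D 1) μ ν = 0` in place of `hD2₁` ⟹ the lead's `D1Sum Lc Js (JcComp hLc N cΛ cB (Roots.ctr Lc) P) μ ν`. -/
theorem d1Sum_JcComp_ctr_nested_of_hessKer_laws_fed_wStep (hLc : Odd Lc) (N : ℕ) (cΛ cB : ℝ) (P : Pins)
    (AF : ℕ → MKer 4 FF) (𝒱F : ℕ → Fin 4 → (Fin 4 → ℤ) → MKer 4 FF) (𝒲F : ℕ → Fin 4 → (Fin 4 → ℤ) → Fin 4 → (Fin 4 → ℤ) → MKer 4 FF)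
    (AG : ℕ → MKer 4 FG) (𝒱G : ℕ → Fin 4 → (Fin 4 → ℤ) → MKer 4 FG) (𝒲G : ℕ → Fin 4 → (Fin 4 → ℤ) → Fin 4 → (Fin 4 → ℤ) → MKer 4 FG)
    (D : ℕ → EKer 4) (μ ν : Fin 4)
    (hlaw : ∀ j : ℕ, 1 ≤ j → ∀ (μ ν : Fin 4) (z : Fin 4 → ℤ),
      hessKer (AN (Roots.ctr Lc) j) (VN (Roots.ctr Lc) P j) (WN (Roots.ctr Lc) P j) μ ν z
        = hessKer (AF j) (𝒱F j) (𝒲F j) μ ν z + hessKer (AG j) (𝒱G j) (𝒲G j) μ ν z + D j μ ν z)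
    (hF₁ : ∀ (μ ν : Fin 4) (z : Fin 4 → ℤ),
      hessKer (AF 1) (𝒱F 1) (𝒲F 1) μ ν z
        = (Lc : ℝ) ^ 8 * dressedEntry (wStep Lc 1) (TshotOf Lc (JcComp hLc N cΛ cB (Roots.ctr Lc) P) 1) ((Lc : ℤ) • z) μ ν)
    (htr' : ∀ j : ℕ, 1 ≤ j → ∀ (μ ν : Fin 4) (z : Fin 4 → ℤ),
      hessKer (AF (j + 1)) (𝒱F (j + 1)) (𝒲F (j + 1)) μ ν z
        = (Lc : ℝ) ^ 8 * dressedEntry (wStep Lc (j + 1))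
            (fun c e t => hessKer (AN (Roots.ctr Lc) j) (VN (Roots.ctr Lc) P j) (WN (Roots.ctr Lc) P j) c e t - D j c e t) ((Lc : ℤ) • z) μ ν)
    (hG : ∀ j : ℕ, 1 ≤ j → ∀ (μ ν : Fin 4) (z : Fin 4 → ℤ),
      hessKer (AG j) (𝒱G j) (𝒲G j) μ ν z = TbalOf Lc (JsB12CombShSym hLc N (symTablesAn1S2 3 Lc cΛ) cΛ cB) j μ ν z)
    (hT0 : ∀ j (c e : Fin 4), HasSum (TbalOf Lc (JsB12CombShSym hLc N (symTablesAn1S2 3 Lc cΛ) cΛ cB) j c e) 0)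
    (hT1 : ∀ j (c e ρ : Fin 4), HasSum (fun t : Fin 4 → ℤ => t ρ • TbalOf Lc (JsB12CombShSym hLc N (symTablesAn1S2 3 Lc cΛ) cΛ cB) j c e t) 0)
    (hDA : ∀ j, 1 ≤ j → ∀ c e : Fin 4, AbsMoment₂ (D j c e))
    (hDtr : ∀ j : ℕ, 1 ≤ j → ∀ (μ ν : Fin 4) (z : Fin 4 → ℤ),
      D (j + 1) μ ν z = (Lc : ℝ) ^ 8 * dressedEntry (wStep Lc (j + 1)) (D j) ((Lc : ℤ) • z) μ ν)
    (hD0₁ : ∀ c e : Fin 4, HasSum (D 1 c e) 0)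
    (hD1₁ : ∀ c e ρ : Fin 4, HasSum (fun t : Fin 4 → ℤ => t ρ • D 1 c e t) 0) (hDF₁ : secondMoment (D 1) μ ν = 0) :
    D1Sum Lc (JsB12CombShSym hLc N (symTablesAn1S2 3 Lc cΛ) cΛ cB) (JcComp hLc N cΛ cB (Roots.ctr Lc) P) μ ν :=
  d1Sum_anchored_of_kernel_laws_fed_wStep hLc N cΛ cB (JcComp hLc N cΛ cB (Roots.ctr Lc) P) (JcComp_one hLc N cΛ cB (Roots.ctr Lc) P)
    (fun j => hessKer (AN (Roots.ctr Lc) j) (VN (Roots.ctr Lc) P j) (WN (Roots.ctr Lc) P j))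
    (fun j => hessKer (AF j) (𝒱F j) (𝒲F j)) (fun j => hessKer (AG j) (𝒱G j) (𝒲G j)) D μ ν
    hlaw (hN_JcComp hLc N cΛ cB (Roots.ctr Lc) P) hF₁ htr' hG hT0 hT1 hDA hDtr hD0₁ hD1₁ hDF₁

end ReadoutNested

end Summit.QuantumFields.BalabanUV.Beta.FP.StepRecursionFeedNestedCompFed

end
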